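import Mathlib
import Literature.Probability.RandomPlanarGeometry.HexParafermion
import Literature.Probability.RandomPlanarGeometry.HexSAW

/-!
# Sketch — first lemmas of the three crux idea cards for `HexTight` (stmt-CriticalPhenomena-5423)

Each `def … : Prop` below is the `First lemma:` of one card; they only need to ELABORATE here
(crux-ideate stage, no skeleton). All constants are existing declarations of
`HexParafermion.lean` / `HexSAW.lean` / `TriangularLattice.lean`.
-/

namespace Summit.CriticalPhenomena.SAWScalingLimit.Cruxes.HexTight.Sketch

open scoped BigOperators
open Classical
open Literature.Probability.LatticeModels
open Literature.Probability.RandomPlanarGeometry.SAW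

/-- Shorthand: the DCS observable at `x_c`, `σ = 5/8`. -/
noncomputable abbrev F (Λ : Finset HexVertex) (a : Sym2 HexVertex) : Sym2 HexVertex → ℂ :=
  hexParafermionicObservable Λ a hexCriticalFugacity (5 / 8)

/-- Card `differentiated-sum-rule`, first lemma (a): the DIFFERENCE FLOW `D = F^Λ − F^{Λ'}` of two
nested simply connected domains sharing the boundary source `a` satisfies the Duminil-Copin–Smirnov
vertex relation at every vertex of the smaller domain (Lemma 1 twice; the source terms cancel since
`F^Λ(a) = F^{Λ'}(a) = 1`). Provable now from `DuminilCopinSmirnov2012_lemma1_holds`. -/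
def DiffFlowVertexRelation : Prop :=
  ∀ (Λ Λ' : Finset HexVertex), Λ' ⊆ Λ → hexDomainSimplyConnected Λ → hexDomainSimplyConnected Λ' →
    ∀ a ∈ hexDomainBoundary Λ, a ∈ hexDomainBoundary Λ' → ∀ v ∈ Λ', ∀ p q r : HexVertex,
      hexGraph.Adj v p → hexGraph.Adj v q → hexGraph.Adj v r → p ≠ q → q ≠ r → p ≠ r →
        (hexMidpoint s(v, p) - hexCenter v) * (F Λ a s(v, p) - F Λ' a s(v, p)) +
          (hexMidpoint s(v, q) - hexCenter v) * (F Λ a s(v, q) - F Λ' a s(v, q)) +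
          (hexMidpoint s(v, r) - hexCenter v) * (F Λ a s(v, r) - F Λ' a s(v, r)) = 0

/-- Card `differentiated-sum-rule`, first lemma (b): the summed form — the STRONG-MARKOV IDENTITY.
Summing (a) over `v ∈ Λ'`, interior mid-edges of `Λ'` cancel and one is left with the boundary
mid-edges of `Λ'`, which are either MAIN (outer endpoint `u ∉ Λ`) or DOOR (`u ∈ Λ ∖ Λ'`); the door
flux of `F^Λ` is rewritten, by the relation summed over `Λ ∖ Λ'` (no source there), as MINUS the flux
of `F^Λ` through the boundary mid-edges of `Λ` hanging off `U = Λ ∖ Λ'` ("walls of `U`"):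
MAIN(`F^Λ − F^{Λ'}`) = DOOR(`F^{Λ'}`) − WALL(`F^Λ`), all fluxes oriented from the inner vertex. Every term is a
boundary value: on main mid-edges `F^Λ − F^{Λ'}` is `e^{-iσW}·(x_c-weight of arcs `a → h` visiting
`U`)`, on walls `F^Λ` and on the door `F^{Λ'}` are `e^{-iσW}·(arc weights)` with the winding `W`
deterministic. Verified to `1e-15` by exact enumeration on honeycomb cell domains with pockets
and with holes (folder `exp/`, kit job j006410). -/
def StrongMarkovIdentity : Prop :=
  ∀ (Λ Λ' : Finset HexVertex), Λ' ⊆ Λ → hexDomainSimplyConnected Λ → hexDomainSimplyConnected Λ' →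
    ∀ a ∈ hexDomainBoundary Λ, a ∈ hexDomainBoundary Λ' →
      (∑ v ∈ Λ', ∑ᶠ u ∈ {u : HexVertex | hexGraph.Adj v u ∧ u ∉ Λ},
          (hexMidpoint s(v, u) - hexCenter v) * (F Λ a s(v, u) - F Λ' a s(v, u))) =
        (∑ v ∈ Λ', ∑ᶠ u ∈ {u : HexVertex | hexGraph.Adj v u ∧ u ∈ Λ \ Λ'},
            (hexMidpoint s(v, u) - hexCenter v) * F Λ' a s(v, u)) -
          ∑ v ∈ Λ \ Λ', ∑ᶠ u ∈ {u : HexVertex | hexGraph.Adj v u ∧ u ∉ Λ},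
            (hexMidpoint s(v, u) - hexCenter v) * F Λ a s(v, u)

/-- Card `tip-renewal-complementarity`, first lemma (a): the COMPLEMENTARITY FLOOR — a gluing-free LOWER
bound. Summing Lemma 1 over all of `Λ` gives `Σ_{h ∈ ∂Ω} (h − v_h) F(h) = 0` with `F(a) = 1`
included, so `‖Σ_{h ≠ a} (h − v_h) F(h)‖ = ‖a − v_a‖` and, all half-edges having the same length,
`Σ_{h ∈ ∂Ω, h ≠ a} ‖F(h)‖ ≥ 1`: the total `x_c`-weight of boundary-to-boundary arcs from `a` is at
least `1` in EVERY simply connected domain, with no hypothesis on windings. Provable now. -/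
def ComplementarityFloor : Prop :=
  ∀ (Λ : Finset HexVertex), hexDomainSimplyConnected Λ → ∀ a ∈ hexDomainBoundary Λ,
    (1 : ℝ) ≤ ∑ v ∈ Λ, ∑ᶠ u ∈ {u : HexVertex | hexGraph.Adj v u ∧ u ∉ Λ ∧ s(v, u) ≠ a},
      ‖F Λ a s(v, u)‖

/-- Cards `continuation-value-reverse-holder` (first lemma) and `tip-renewal-complementarity` (first
lemma (b)): RENEWAL GLUING at a cut — exact super-multiplicativity of the pinned partition function,
the only loss-free way to factorise `Z_Λ(a → b)` (used around the endpoint `b` in the former card and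
around the tip, at lattice scale, in the latter): for every vertex set `B ⊆ Λ` (the "ball"), concatenating an arc of `Λ ∖ B`
from `a` to a door mid-edge `{v,u}` (`v ∉ B`, `u ∈ B`) with a walk of `B` from that mid-edge to `b`
gives a self-avoiding walk of `Λ` (disjoint vertex sets), lengths add and `x_c`-weights multiply.
Provable now (an injection into `HexMidEdgeSAW Λ a b`). -/
def RenewalGluing : Prop :=
  ∀ (Λ B : Finset HexVertex) (a b : Sym2 HexVertex), B ⊆ Λ →
    (∑ v ∈ Λ \ B, ∑ u ∈ B,
        (if hexGraph.Adj v u then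
          (∑ γ₁ : HexMidEdgeSAW (Λ \ B) a s(v, u), hexCriticalFugacity ^ γ₁.length) *
            (∑ γ₂ : HexMidEdgeSAW B s(v, u) b, hexCriticalFugacity ^ γ₂.length)
        else 0)) ≤
      ∑ γ : HexMidEdgeSAW Λ a b, hexCriticalFugacity ^ γ.length

end Summit.CriticalPhenomena.SAWScalingLimit.Cruxes.HexTight.Sketch
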